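import Literature.AlgebraicTopology.SingularHomology.MayerVietorisFiniteness
import HarnessLib

/-!
# Wilder's finiteness induction for singular homology: images `Im(Hₙ(V) → Hₙ(U))`

Second of three files proving that compact topological manifolds have finitely generated singular
homology (Hatcher, *Algebraic Topology* (2002), App. A, Cor. A.8–A.9) by R. L. Wilder's method
as in G. E. Bredon, *Sheaf Theory* (1997), §II.17, for the covariant analogue of Bredon's
condition `(jⁿ)`:

> `Q(U)`: for every open `V` with compact closure `closure V ⊆ U` and every `n`, the image of
> `Hₙ(V; M) → Hₙ(U; M)` is a finitely generated module

(`Literature.AlgebraicTopology.SingularHomology.HasFGInclRanges R M U`; the image is `Literature.AlgebraicTopology.SingularHomology.inclRange`).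

* `Literature.AlgebraicTopology.SingularHomology.HasFGInclRanges.union` — **the inductive step** (Bredon 1997, II.17, proof of
  Thm. 17.4, the Mayer–Vietoris diagram with Lemma 17.3): in a locally compact regular space, if
  `Q` holds for the open set `U₁` and for every open subset of the open set `U₂`, then `Q` holds
  for `U₁ ∪ U₂`. Given `closure V ⊆ U₁ ∪ U₂` one shrinks twice
  (`exists_open_between_union`: `closure V ⊆ V₁ ∪ V₂`, `closure Vᵢ ⊆ Wᵢ`, `closure Wᵢ ⊆ Uᵢ`,
  all closures compact) and applies the ladder lemma `fg_range_comp_of_ladder` to the three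
  Mayer–Vietoris sequences of `V₁ ∪ V₂ ⊆ W₁ ∪ W₂ ⊆ U₁ ∪ U₂` (rows exact at `Hₙ(S)` by
  `mayerVietoris.exact₂_holds`, Bredon's `Im ks` through `δ_naturality_holds`; in degree `0` the
  row ends by `ψ_surjective_zero`).
* `Literature.AlgebraicTopology.SingularHomology.HereditarilyHasFGInclRanges` — `Q` for all open subsets; stable under finite unions
  (`.union`, `.biUnion_finset`; Bredon's collection `𝔖`), holds for `∅`.
* `Literature.AlgebraicTopology.SingularHomology.HasFGInclRanges.of_openPartialHomeomorph` — transport of `Q` along a chart: if every open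
  subset of `Y` satisfies `Q` and `e` is an open partial homeomorphism `X ⇀ Y`, then every open
  `U ⊆ e.source` satisfies `Q`.

The base case (open subsets of Euclidean space) and the conclusion for compact manifolds are in
`…CompactManifoldFiniteness`. Everything here is proved.

## References

* G. E. Bredon, *Sheaf Theory*, 2nd ed., GTM 170, Springer 1997, §II.17, Lemma 17.3, Thm. 17.4
  and its proof (conditions `(jⁿ)`, `(jⁿ_•)`, the collection `𝔖`). [Bredon1997]
* A. Hatcher, *Algebraic Topology*, CUP 2002, §2.2 pp. 149–150, App. A Cor. A.8–A.9. [HatcherAT2002]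
-/

noncomputable section

open CategoryTheory Limits Set

universe u v

namespace Literature.AlgebraicTopology.SingularHomology

variable (R : Type v) [CommRing R] (M : Type v) [AddCommGroup M] [Module R M]
variable {X : Type u} [TopologicalSpace X]

/-! ### The property `Q(U)` -/

/-- The image `Im(Hₙ(V; M) → Hₙ(U; M))` of the map induced by an inclusion of subspaces `V ⊆ U`
of `X` (cf. Bredon 1997, II.17, Thm. 17.4: the images `Im jⁿ_{U,V}` of condition `(jⁿ)`, there for
cohomology with compact supports; here the analogous images for singular homology). [folklore] -/
abbrev inclRange {V U : Set X} (h : V ⊆ U) (n : ℕ) : Submodule R (singularHomology R M U n) :=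
  LinearMap.range (singularHomology.map R M (subsetInclusion h) n).hom

/-- **Wilder's condition `Q(U)`** for a subset `U ⊆ X` (the singular-homology analogue of condition
`(jⁿ)`, all `n`, of Bredon 1997, II.17, Thm. 17.4, which is stated there for cohomology with
compact supports): for every open `V` whose closure is compact and contained in `U`, the image of
`Hₙ(V; M) → Hₙ(U; M)` is finitely generated, for all `n`. [folklore] -/
def HasFGInclRanges (U : Set X) : Prop :=
  ∀ ⦃V : Set X⦄, IsOpen V → IsCompact (closure V) → ∀ (hVU : closure V ⊆ U) (n : ℕ),
    (inclRange R M (subset_closure.trans hVU) n).FG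

variable {R M}

/-- **Shrinking a compact set inside a binary open cover** in a locally compact regular space:
if `K ⊆ U₁ ∪ U₂` is compact then `K ⊆ V₁ ∪ V₂` for open `Vᵢ` with compact closures
`closure Vᵢ ⊆ Uᵢ` (Mathlib's `IsCompact.binary_compact_cover` `K = K₁ ∪ K₂`, `Kᵢ ⊆ Uᵢ` compact,
followed by `exists_open_between_and_isCompact_closure` for each `Kᵢ`; Bredon 1997, II.17, proof
of 17.4: "construct open sets … with the closure of each contained in the next"). [folklore] -/
lemma exists_open_between_union [LocallyCompactSpace X] [RegularSpace X] {K U₁ U₂ : Set X}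
    (hK : IsCompact K) (hU₁ : IsOpen U₁) (hU₂ : IsOpen U₂) (hKU : K ⊆ U₁ ∪ U₂) :
    ∃ V₁ V₂ : Set X, IsOpen V₁ ∧ IsOpen V₂ ∧ IsCompact (closure V₁) ∧ IsCompact (closure V₂) ∧
      closure V₁ ⊆ U₁ ∧ closure V₂ ⊆ U₂ ∧ K ⊆ V₁ ∪ V₂ := by
  obtain ⟨K₁, K₂, hK₁, hK₂, hK₁U, hK₂U, rfl⟩ := hK.binary_compact_cover hU₁ hU₂ hKU
  obtain ⟨V₁, hV₁, hKV₁, hV₁U, hV₁c⟩ := exists_open_between_and_isCompact_closure hK₁ hU₁ hK₁U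
  obtain ⟨V₂, hV₂, hKV₂, hV₂U, hV₂c⟩ := exists_open_between_and_isCompact_closure hK₂ hU₂ hK₂U
  exact ⟨V₁, V₂, hV₁, hV₂, hV₁c, hV₂c, hV₁U, hV₂U, union_subset_union hKV₁ hKV₂⟩

/-- Monotonicity of the image in the smaller set: for `V ⊆ V' ⊆ U`,
`Im(Hₙ(V) → Hₙ(U)) ≤ Im(Hₙ(V') → Hₙ(U))` (the first map factors through the second). [folklore] -/
lemma inclRange_mono_left {V V' U : Set X} (h : V ⊆ V') (h' : V' ⊆ U) (n : ℕ) :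
    inclRange R M (h.trans h') n ≤ inclRange R M h' n := by
  have : subsetInclusion (h.trans h') = (subsetInclusion h').comp (subsetInclusion h) := rfl
  rw [inclRange, this, range_map_comp]
  exact LinearMap.map_le_range

/-- Pushing an image forward: for `V ⊆ U ⊆ W`, `Im(Hₙ(V) → Hₙ(W))` is the image of
`Im(Hₙ(V) → Hₙ(U))` under `Hₙ(U) → Hₙ(W)`. [folklore] -/
lemma inclRange_trans {V U W : Set X} (h : V ⊆ U) (h' : U ⊆ W) (n : ℕ) :
    inclRange R M (h.trans h') n =
      (inclRange R M h n).map (singularHomology.map R M (subsetInclusion h') n).hom := by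
  have : subsetInclusion (h.trans h') = (subsetInclusion h').comp (subsetInclusion h) := rfl
  rw [inclRange, this, range_map_comp]

namespace HasFGInclRanges

/-- The image of `Hₙ((A ∪ B) ↓∩ A) → Hₙ(S)` along `A ⊆ U ⊆ S` is the push-forward to `Hₙ(S)` of
`Im(Hₙ(A) → Hₙ(U))` (read through `SphereComplement.preimageValHomeomorphOfSubset`); in particular
it is finitely generated when the latter is. [folklore] -/
lemma fg_range_map_left {A B U S : Set X} (hAU : A ⊆ U) (hUS : U ⊆ S) (hABS : A ∪ B ⊆ S)
    (n : ℕ) (h : (inclRange R M hAU n).FG) :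
    (LinearMap.range (singularHomology.map R M
      ((subsetInclusion hABS).comp (subsetIncl (Subtype.val ⁻¹' A : Set ↥(A ∪ B)))) n).hom).FG := by
  have e : (subsetInclusion hABS).comp (subsetIncl (Subtype.val ⁻¹' A : Set ↥(A ∪ B))) =
      ((subsetInclusion hUS).comp (subsetInclusion hAU)).comp
        (SphereComplement.preimageValHomeomorphOfSubset (subset_union_left : A ⊆ A ∪ B) :
          C(↥(Subtype.val ⁻¹' A : Set ↥(A ∪ B)), ↥A)) := rfl
  rw [e, range_map_comp_homeomorph, range_map_comp]
  exact h.map _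

/-- The same for the trace of `B`: the image of `Hₙ((A ∪ B) ↓∩ B) → Hₙ(S)` along `B ⊆ U ⊆ S` is
finitely generated when `Im(Hₙ(B) → Hₙ(U))` is. [folklore] -/
lemma fg_range_map_right {A B U S : Set X} (hBU : B ⊆ U) (hUS : U ⊆ S) (hABS : A ∪ B ⊆ S)
    (n : ℕ) (h : (inclRange R M hBU n).FG) :
    (LinearMap.range (singularHomology.map R M
      ((subsetInclusion hABS).comp (subsetIncl (Subtype.val ⁻¹' B : Set ↥(A ∪ B)))) n).hom).FG := by
  have e : (subsetInclusion hABS).comp (subsetIncl (Subtype.val ⁻¹' B : Set ↥(A ∪ B))) =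
      ((subsetInclusion hUS).comp (subsetInclusion hBU)).comp
        (SphereComplement.preimageValHomeomorphOfSubset (subset_union_right : B ⊆ A ∪ B) :
          C(↥(Subtype.val ⁻¹' B : Set ↥(A ∪ B)), ↥B)) := rfl
  rw [e, range_map_comp_homeomorph, range_map_comp]
  exact h.map _

/-- The image of the composite `Hₙ(↓A) ⊞ Hₙ(↓B) →ψ Hₙ(A ∪ B) → Hₙ(S)` is finitely generated as
soon as `Im(Hₙ(A) → Hₙ(U₁))` and `Im(Hₙ(B) → Hₙ(U₂))` are, for `A ⊆ U₁ ⊆ S`, `B ⊆ U₂ ⊆ S`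
(the hypothesis "`Im th` small" of Bredon's Lemma II.17.3 as used in the proof of Thm. 17.4). [folklore] -/
lemma fg_range_ψ_comp {A B U₁ U₂ S : Set X} (hA : A ⊆ U₁) (hB : B ⊆ U₂) (h₁ : U₁ ⊆ S)
    (h₂ : U₂ ⊆ S) (hABS : A ∪ B ⊆ S) (n : ℕ)
    (hfA : (inclRange R M hA n).FG) (hfB : (inclRange R M hB n).FG) :
    (LinearMap.range ((singularHomology.map R M (subsetInclusion hABS) n).hom ∘ₗ
      (mayerVietoris.ψ R M (Subtype.val ⁻¹' A : Set ↥(A ∪ B)) (Subtype.val ⁻¹' B) n).hom)).FG := by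
  rw [← ModuleCat.hom_comp, mayerVietoris.ψ]
  have : biprod.desc (singularHomology.map R M (subsetIncl (Subtype.val ⁻¹' A : Set ↥(A ∪ B))) n)
      (singularHomology.map R M (subsetIncl (Subtype.val ⁻¹' B : Set ↥(A ∪ B))) n) ≫
        singularHomology.map R M (subsetInclusion hABS) n =
      biprod.desc (singularHomology.map R M
          ((subsetInclusion hABS).comp (subsetIncl (Subtype.val ⁻¹' A : Set ↥(A ∪ B)))) n)
        (singularHomology.map R M
          ((subsetInclusion hABS).comp (subsetIncl (Subtype.val ⁻¹' B : Set ↥(A ∪ B)))) n) := by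
    refine biprod.hom_ext' _ _ ?_ ?_
    · rw [biprod.inl_desc_assoc, biprod.inl_desc, singularHomology.map_comp]
    · rw [biprod.inr_desc_assoc, biprod.inr_desc, singularHomology.map_comp]
  rw [this, range_biprod_desc]
  exact (fg_range_map_left hA h₁ hABS n hfA).sup (fg_range_map_right hB h₂ hABS n hfB)

/-- **Wilder's inductive step** (Bredon, *Sheaf Theory*, II.17, proof of Thm. 17.4 with
Lemma 17.3; homology version). In a locally compact regular space let `U₁`, `U₂` be open, and
suppose `Q(U₁)` and `Q(W)` for every open `W ⊆ U₂`. Then `Q(U₁ ∪ U₂)`: for `closure V ⊆ U₁ ∪ U₂`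
compact, shrink to `closure V ⊆ V₁ ∪ V₂`, `closure Vᵢ ⊆ Wᵢ`, `closure Wᵢ ⊆ Uᵢ` and apply the
ladder lemma to the Mayer–Vietoris sequences of `V₁ ∪ V₂ ⊆ W₁ ∪ W₂ ⊆ U₁ ∪ U₂`
(`Hₙ(↓W₁) ⊞ Hₙ(↓W₂) → Hₙ(W₁ ∪ W₂) → Hₙ₋₁(↓W₁ ∩ ↓W₂)` exact, `δ` natural): the outer images are
finitely generated by `Q(U₁)`, `Q(U₂)` (through `W₁`, `W₂`) and by `Q(W₁ ∩ W₂)` (through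
`V₁ ∩ V₂`), hence so is `Im(Hₙ(V₁ ∪ V₂) → Hₙ(U₁ ∪ U₂)) ⊇ Im(Hₙ(V) → Hₙ(U₁ ∪ U₂))`. This is the
argument printed by Bredon for condition `(jⁿ)` of compactly supported sheaf cohomology, run for
singular homology. [folklore] -/
theorem union [IsNoetherianRing R] [LocallyCompactSpace X] [RegularSpace X] {U₁ U₂ : Set X}
    (hU₁ : IsOpen U₁) (hU₂ : IsOpen U₂) (h₁ : HasFGInclRanges R M U₁)
    (h₂ : ∀ W ⊆ U₂, IsOpen W → HasFGInclRanges R M W) :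
    HasFGInclRanges R M (U₁ ∪ U₂) := by
  intro V hV hVc hVU n
  -- two shrinkings
  obtain ⟨W₁, W₂, hW₁, hW₂, hW₁c, hW₂c, hW₁U, hW₂U, hKW⟩ :=
    exists_open_between_union hVc hU₁ hU₂ hVU
  obtain ⟨V₁, V₂, hV₁, hV₂, hV₁c, hV₂c, hV₁W, hV₂W, hKV⟩ :=
    exists_open_between_union hVc hW₁ hW₂ hKW
  have hW₁U' : W₁ ⊆ U₁ := subset_closure.trans hW₁U
  have hW₂U' : W₂ ⊆ U₂ := subset_closure.trans hW₂U
  have hV₁W' : V₁ ⊆ W₁ := subset_closure.trans hV₁W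
  have hV₂W' : V₂ ⊆ W₂ := subset_closure.trans hV₂W
  have h₁₂ : V₁ ∪ V₂ ⊆ W₁ ∪ W₂ := union_subset_union hV₁W' hV₂W'
  have h₂₃ : W₁ ∪ W₂ ⊆ U₁ ∪ U₂ := union_subset_union hW₁U' hW₂U'
  have h₁₃ : V₁ ∪ V₂ ⊆ U₁ ∪ U₂ := h₁₂.trans h₂₃
  -- it suffices to bound the image of `Hₙ(V₁ ∪ V₂) → Hₙ(U₁ ∪ U₂)`
  suffices hS : (inclRange R M h₁₃ n).FG by
    exact hS.of_le (inclRange_mono_left (subset_closure.trans hKV) h₁₃ n)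
  have hU₂Q : HasFGInclRanges R M U₂ := h₂ U₂ subset_rfl hU₂
  -- images of the pieces
  have hfW₁ : (inclRange R M hW₁U' n).FG := h₁ hW₁ hW₁c hW₁U n
  have hfW₂ : (inclRange R M hW₂U' n).FG := hU₂Q hW₂ hW₂c hW₂U n
  have hβ := fg_range_ψ_comp hW₁U' hW₂U' subset_union_left subset_union_right h₂₃ n hfW₁ hfW₂
  -- excision and covers
  have hexc₂ := relativeSingularHomology.isIso_map_of_interior_union_interior_holds R M
    (X := ↥(W₁ ∪ W₂))
  have hcov₂ := SphereComplement.interior_union_interior_eq_univ hW₁ hW₂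
  cases n with
  | zero =>
    have hsurj := mayerVietoris.ψ_surjective_zero R M _ _ hexc₂ hcov₂
    rw [LinearMap.range_comp_of_range_eq_top _ (LinearMap.range_eq_top.mpr hsurj)] at hβ
    rw [inclRange, show subsetInclusion h₁₃ = (subsetInclusion h₂₃).comp (subsetInclusion h₁₂)
      from rfl, range_map_comp]
    exact hβ.of_le LinearMap.map_le_range
  | succ m =>
    have hexc₁ := relativeSingularHomology.isIso_map_of_interior_union_interior_holds R M
      (X := ↥(V₁ ∪ V₂))
    have hcov₁ := SphereComplement.interior_union_interior_eq_univ hV₁ hV₂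
    -- the map of triads `(V₁ ∪ V₂; ↓V₁, ↓V₂) → (W₁ ∪ W₂; ↓W₁, ↓W₂)`
    have hmapl : MapsTo (subsetInclusion h₁₂) (Subtype.val ⁻¹' V₁ : Set ↥(V₁ ∪ V₂))
        (Subtype.val ⁻¹' W₁ : Set ↥(W₁ ∪ W₂)) := fun x hx ↦ hV₁W' hx
    have hmapr : MapsTo (subsetInclusion h₁₂) (Subtype.val ⁻¹' V₂ : Set ↥(V₁ ∪ V₂))
        (Subtype.val ⁻¹' W₂ : Set ↥(W₁ ∪ W₂)) := fun x hx ↦ hV₂W' hx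
    have hnat := mayerVietoris.δ_naturality_holds R M hexc₁ hexc₂ (subsetInclusion h₁₂)
      hmapl hmapr hcov₁ hcov₂ m
    -- finite generation of the image on the intersections, from `Q(W₁ ∩ W₂)`
    have hVW : V₁ ∩ V₂ ⊆ W₁ ∩ W₂ := inter_subset_inter hV₁W' hV₂W'
    have hγ' : (inclRange R M hVW m).FG := by
      refine h₂ (W₁ ∩ W₂) (inter_subset_right.trans hW₂U') (hW₁.inter hW₂) (hV₁.inter hV₂)
        (hV₁c.of_isClosed_subset isClosed_closure (closure_mono inter_subset_left)) ?_ m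
      exact subset_inter ((closure_mono inter_subset_left).trans hV₁W)
          ((closure_mono inter_subset_right).trans hV₂W)
    have hγ : (LinearMap.range (singularHomology.map R M
        (subsetRestrict (subsetInclusion h₁₂) (hmapl.inter_inter hmapr)) m).hom).FG := by
      let eV : ↥((Subtype.val ⁻¹' V₁ : Set ↥(V₁ ∪ V₂)) ∩ Subtype.val ⁻¹' V₂) ≃ₜ ↥(V₁ ∩ V₂) :=
        SphereComplement.preimageValHomeomorphOfSubset
          (inter_subset_left.trans subset_union_left : V₁ ∩ V₂ ⊆ V₁ ∪ V₂)
      let eW : ↥((Subtype.val ⁻¹' W₁ : Set ↥(W₁ ∪ W₂)) ∩ Subtype.val ⁻¹' W₂) ≃ₜ ↥(W₁ ∩ W₂) :=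
        SphereComplement.preimageValHomeomorphOfSubset
          (inter_subset_left.trans subset_union_left : W₁ ∩ W₂ ⊆ W₁ ∪ W₂)
      have e : ((eW : C(_, ↥(W₁ ∩ W₂))).comp
          (subsetRestrict (subsetInclusion h₁₂) (hmapl.inter_inter hmapr))) =
          (subsetInclusion hVW).comp (eV : C(_, ↥(V₁ ∩ V₂))) := rfl
      have e' : subsetRestrict (subsetInclusion h₁₂) (hmapl.inter_inter hmapr) =
          (eW.symm : C(↥(W₁ ∩ W₂), _)).comp
            ((subsetInclusion hVW).comp (eV : C(_, ↥(V₁ ∩ V₂)))) := by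
        rw [← e]; ext x; simp
      rw [e', range_map_comp, range_map_comp_homeomorph]
      exact hγ'.map _
    -- the ladder
    -- Bredon's `Im ks`: `Im(Hₙ(V₁ ∪ V₂) → Hₙ(W₁ ∪ W₂) →δ Hₙ₋₁(↓W₁ ∩ ↓W₂))`, finitely generated
    -- by naturality of `δ` and `hγ`
    have hks : (LinearMap.range ((mayerVietoris.δ R M (Subtype.val ⁻¹' W₁ : Set ↥(W₁ ∪ W₂))
        (Subtype.val ⁻¹' W₂) hexc₂ hcov₂ m).hom ∘ₗ
          (singularHomology.map R M (subsetInclusion h₁₂) (m + 1)).hom)).FG := by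
      rw [← ModuleCat.hom_comp, ← hnat, ModuleCat.hom_comp, LinearMap.range_comp]
      exact hγ.of_le LinearMap.map_le_range
    have key := fg_range_comp_of_ladder
      (mayerVietoris.ψ R M (Subtype.val ⁻¹' W₁ : Set ↥(W₁ ∪ W₂)) (Subtype.val ⁻¹' W₂) (m + 1)).hom
      (mayerVietoris.δ R M (Subtype.val ⁻¹' W₁ : Set ↥(W₁ ∪ W₂)) (Subtype.val ⁻¹' W₂)
        hexc₂ hcov₂ m).hom
      (by rw [← (mayerVietoris.exact₂_holds R M _ _ hexc₂ hcov₂ m).moduleCat_range_eq_ker])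
      (singularHomology.map R M (subsetInclusion h₁₂) (m + 1)).hom
      (singularHomology.map R M (subsetInclusion h₂₃) (m + 1)).hom hks hβ
    rw [← ModuleCat.hom_comp, ← singularHomology.map_comp] at key
    exact key

end HasFGInclRanges

/-! ### Hereditary version, finite unions, transport along charts -/

variable (R M) in
/-- **`Q` hereditarily**: every open subset of `U` satisfies `Q` (cf. the collection `𝔖` in the
proof of Bredon 1997, II.17.4). [folklore] -/
def HereditarilyHasFGInclRanges (U : Set X) : Prop :=
  ∀ ⦃W : Set X⦄, W ⊆ U → IsOpen W → HasFGInclRanges R M W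

/-- The singular homology of the empty subspace vanishes (no singular simplices; transported from
the concrete complex, `isZero_csingularHomology_of_isEmpty`). [folklore] -/
lemma isZero_singularHomology_empty (n : ℕ) : IsZero (singularHomology R M (↥(∅ : Set X)) n) :=
  haveI : IsEmpty (↥(∅ : Set X)) := by simp
  (isZero_csingularHomology_of_isEmpty R M n).of_iso (csingularHomology.compIso R M _ n).symm

namespace HereditarilyHasFGInclRanges

/-- A hereditarily-`Q` open set satisfies `Q`. [folklore] -/
lemma hasFGInclRanges {U : Set X} (h : HereditarilyHasFGInclRanges R M U) (hU : IsOpen U) :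
    HasFGInclRanges R M U :=
  h subset_rfl hU

/-- The empty set is hereditarily `Q` (all the homology groups involved vanish). [folklore] -/
lemma empty : HereditarilyHasFGInclRanges R M (∅ : Set X) := by
  intro W hW _ V _ _ hVU n
  have hV : V = ∅ := subset_empty_iff.mp ((subset_closure.trans hVU).trans hW)
  subst hV
  haveI := ModuleCat.subsingleton_of_isZero (isZero_singularHomology_empty (R := R) (M := M)
    (X := X) n)
  haveI : Module.Finite R (singularHomology R M (↥(∅ : Set X)) n) := inferInstance
  rw [inclRange, ← Submodule.map_top]
  exact Module.Finite.fg_top.map _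

/-- **Binary unions** (Bredon 1997, II.17, proof of Thm. 17.4: `V₁, V₂ ∈ 𝔖 ⇒ V₁ ∪ V₂ ∈ 𝔖`): if
the open sets `U₁`, `U₂` are hereditarily `Q` then so is `U₁ ∪ U₂` — an open `W ⊆ U₁ ∪ U₂` is
`(W ∩ U₁) ∪ (W ∩ U₂)` and `HasFGInclRanges.union` applies. [folklore] -/
theorem union [IsNoetherianRing R] [LocallyCompactSpace X] [RegularSpace X] {U₁ U₂ : Set X}
    (hU₁ : IsOpen U₁) (hU₂ : IsOpen U₂) (h₁ : HereditarilyHasFGInclRanges R M U₁)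
    (h₂ : HereditarilyHasFGInclRanges R M U₂) :
    HereditarilyHasFGInclRanges R M (U₁ ∪ U₂) := by
  intro W hW hWo
  have hW' : W = (W ∩ U₁) ∪ (W ∩ U₂) := by
    rw [← inter_union_distrib_left, inter_eq_self_of_subset_left hW]
  rw [hW']
  exact HasFGInclRanges.union (hWo.inter hU₁) (hWo.inter hU₂)
    (h₁ inter_subset_right (hWo.inter hU₁))
    (fun W' hW' hW'o ↦ h₂ (hW'.trans inter_subset_right) hW'o)

/-- **Finite unions**: a finite union of hereditarily-`Q` open sets is hereditarily `Q`
(cf. Bredon 1997, II.17, proof of Thm. 17.4: "`𝔖` contains all …"). [folklore] -/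
theorem biUnion_finset [IsNoetherianRing R] [LocallyCompactSpace X] [RegularSpace X] {ι : Type*}
    (s : Finset ι) (U : ι → Set X) (hUo : ∀ i ∈ s, IsOpen (U i))
    (hU : ∀ i ∈ s, HereditarilyHasFGInclRanges R M (U i)) :
    HereditarilyHasFGInclRanges R M (⋃ i ∈ s, U i) := by
  classical
  induction s using Finset.induction_on with
  | empty => simpa using (empty : HereditarilyHasFGInclRanges R M (∅ : Set X))
  | insert a s ha ih =>
    rw [Finset.set_biUnion_insert]
    have hso : IsOpen (⋃ i ∈ s, U i) :=
      isOpen_biUnion fun i hi ↦ hUo i (Finset.mem_insert_of_mem hi)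
    exact union (hUo a (Finset.mem_insert_self a s)) hso
      (hU a (Finset.mem_insert_self a s))
      (ih (fun i hi ↦ hUo i (Finset.mem_insert_of_mem hi))
        (fun i hi ↦ hU i (Finset.mem_insert_of_mem hi)))

end HereditarilyHasFGInclRanges

/-- **Transport of `Q` along a chart.** Let `e : X ⇀ Y` be an open partial homeomorphism into a
Hausdorff space all of whose open subsets satisfy `Q`. Then every open `U ⊆ e.source` satisfies
`Q`: for `closure V ⊆ U` compact, `e '' V ⊆ e '' U` are open with
`closure (e '' V) = e '' closure V` compact, and `Hₙ(V) → Hₙ(U)` is conjugate to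
`Hₙ(e '' V) → Hₙ(e '' U)` under the homeomorphisms `V ≃ₜ e '' V`, `U ≃ₜ e '' U`
(`OpenPartialHomeomorph.homeomorphOfImageSubsetSource`). [folklore] -/
theorem HasFGInclRanges.of_openPartialHomeomorph {Y : Type u} [TopologicalSpace Y] [T2Space Y]
    (e : OpenPartialHomeomorph X Y) (hY : ∀ U' : Set Y, IsOpen U' → HasFGInclRanges R M U')
    {U : Set X} (hU : IsOpen U) (hUe : U ⊆ e.source) : HasFGInclRanges R M U := by
  intro V hV hVc hVU n
  have hVU' : V ⊆ U := subset_closure.trans hVU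
  have hVe : V ⊆ e.source := hVU'.trans hUe
  have hcVe : closure V ⊆ e.source := hVU.trans hUe
  have hcont : ContinuousOn e (closure V) := e.continuousOn.mono hcVe
  have hcl : closure (e '' V) = e '' closure V :=
    Subset.antisymm ((hVc.image_of_continuousOn hcont).isClosed.closure_subset_iff.mpr
      (image_mono subset_closure)) hcont.image_closure
  have hfg := hY (e '' U) (e.isOpen_image_of_subset_source hU hUe)
    (e.isOpen_image_of_subset_source hV hVe) (hcl ▸ hVc.image_of_continuousOn hcont)
    (hcl ▸ image_mono hVU) n
  set eV := e.homeomorphOfImageSubsetSource hVe rfl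
  set eU := e.homeomorphOfImageSubsetSource hUe rfl
  have hcomm : (eU : C(↥U, ↥(e '' U))).comp (subsetInclusion hVU') =
      (subsetInclusion (image_mono hVU')).comp (eV : C(↥V, ↥(e '' V))) := rfl
  have hcomm' : subsetInclusion hVU' = (eU.symm : C(↥(e '' U), ↥U)).comp
      ((subsetInclusion (image_mono hVU')).comp (eV : C(↥V, ↥(e '' V)))) := by
    rw [← hcomm]; ext x; simp
  change (LinearMap.range (singularHomology.map R M (subsetInclusion hVU') n).hom).FG
  rw [hcomm', range_map_comp, range_map_comp_homeomorph]
  exact hfg.map _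

end Literature.AlgebraicTopology.SingularHomology
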